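import Literature.AlgebraicGeometry.Resolution.WeightedResolutionDatum
import Literature.AlgebraicGeometry.Resolution.RegularSubschemeLocallyIrreducible
import Literature.AlgebraicGeometry.Resolution.StrictNormalCrossingsDescent
import Literature.AlgebraicGeometry.Resolution.MarkedIdealsLemmas
import Literature.AlgebraicGeometry.Resolution.AlterationsLemma32
import Literature.AlgebraicGeometry.Hironaka2017.Lib.RsopSpread
import HarnessLib

/-!
# Powers of the ideal of a regular closed subscheme form a regular weighted centre (all weights `1`)

Route `ResolutionOfSingularities/WeightedInvariant`, door crux `HypersurfaceCentreConstruction`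
(stmt-ResolutionOfSingularities-19897: `∀ p prime, Nonempty (HypersurfaceTerminatingCentreDatum p)`), helper
for the admissibility clause `(iii-a)` of the datum (`ReesAlgebraData.IsRegularWeightedCentre`,
Włodarczyk 2.1.10). Up to now the tree's only inhabitant of `IsRegularWeightedCentre` was the EMPTY centre
(`ReesAlgebraData.isRegularWeightedCentre_unit`). This file proves the first non-trivial one:

* `isRegularWeightedCentre_of_piece_eq_pow` — on a locally Noetherian scheme `Y` whose local
  rings are regular at the points of `V(J)`, if the closed subscheme `V(J)` of the ideal sheaf `J` is REGULAR,
  then every Rees algebra `R` with pieces `Rₙ = Jⁿ` (the Rees algebra `⊕ₙ Jⁿ tⁿ` of the ordinary blow-up of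
  the regular centre `V(J)`) is a regular weighted centre: around every point there is an affine chart
  `(U, u, w ≡ 1)` with `Jⁿ(U) = (u)ⁿ = (u^α : Σ αᵢ ≥ n)` and the `uᵢ` part of a regular system of parameters at
  every point of `V(u) ∩ U` (Włodarczyk 2.1.10 with all weights `aᵢ = 1`: "`uᵢ` are part of a system of
  parameters"; Lemma 4.6.1: the cobordant blow-up of `⊕ Jⁿ tⁿ` is the one at the centre `V(J)` with all
  weights `1`);
* `support_eq_of_piece_eq_pow` — its support is `V(J)`;
* `exists_isRegularWeightedCentre_support_eq` / `…_of_smooth` — packaged existence: every regular closed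
  subscheme `Z` of a regular (resp. smooth over a field) `Y` is the support of a regular weighted centre
  (cf. the door's junk-datum screen «powers of `I_Z`, `Z` a regular stratum of `Sing V(X)`: ADMISSIBLE»).

Ingredients (tree): local equations of a regular centre spread to an affine neighbourhood as ONE system that is
part of a regular system of parameters at EVERY point of the centre (`exists_affineOpen_forall_isRsopPart_germ`),
Matsumura 14.2 (1) ⇒ (2) (`mem_maximalIdeal_of_sum_mul_rsop_mem_sq`), stalks of quasi-coherent ideals as
localisations. Tools proved here: `weightedMonomialIdeal_one_eq_pow`, `ideal_le_of_forall_map_germ_le`,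
`ideal_eq_top_of_forall_not_mem_support`. OURS (summit-side helper, `--supports stmt-…-19897`); no statement of
H. Hironaka's 2017 manuscript is typed or used. AI-written; weaker than expert review.

References: J. Włodarczyk, *Functorial resolution by torus actions*, arXiv:2203.03090, 2.1.10, Lemma 2.1.12,
Lemma 4.6.1 [Wlodarczyk2022]; H. Matsumura, *Commutative Ring Theory*, CUP 1986, Thm. 14.2 [Matsumura1987].
-/

noncomputable section

open CategoryTheory AlgebraicGeometry TopologicalSpace IsLocalRing
open Literature.AlgebraicGeometry.Resolution

set_option linter.dupNamespace false -- mandated namespace of this single-conjunct summit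

namespace Summit.ResolutionOfSingularities.ResolutionOfSingularities.Theorems

universe u

/-! ## §1 Algebra: unit-weight monomial ideals are the powers of `(u)` -/

section Algebra

variable {A : Type*} [CommRing A] {m : ℕ} (u : Fin m → A)

/-- The monomial ideals of a weighted chart are multiplicative: `𝒥_a · 𝒥_b ⊆ 𝒥_{a+b}`
(`u^α · u^β = u^{α+β}`, weights add). [cite: Wlodarczyk2022, Lemma 2.1.12] -/
theorem weightedMonomialIdeal_mul_le (w : Fin m → ℕ) (a b : ℕ) :
    weightedMonomialIdeal u w a * weightedMonomialIdeal u w b ≤ weightedMonomialIdeal u w (a + b) := by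
  unfold weightedMonomialIdeal
  rw [Ideal.span_mul_span', Ideal.span_le]
  rintro _ ⟨x, hx, y, hy, rfl⟩
  obtain ⟨α, hα, rfl⟩ := hx
  obtain ⟨β, hβ, rfl⟩ := hy
  refine Ideal.subset_span ⟨α + β, ?_, ?_⟩
  · have : ∑ i, w i * (α + β) i = ∑ i, w i * α i + ∑ i, w i * β i := by
      simp only [Pi.add_apply, mul_add, Finset.sum_add_distrib]
    omega
  · simp only [Pi.add_apply, pow_add, Finset.prod_mul_distrib]

/-- **With all weights `1` the monomial ideals are the powers of the centre's ideal**: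
`(u^α : Σ αᵢ ≥ n) = (u₁, …, uₘ)ⁿ` (Włodarczyk, Lemma 4.6.1: the Rees algebra `⊕ Jⁿ tⁿ` of an ideal is the
weighted one of the centre `V(J)` with all weights `1`). [cite: Wlodarczyk2022, Lemma 4.6.1] -/
theorem weightedMonomialIdeal_one_eq_pow (n : ℕ) :
    weightedMonomialIdeal u (fun _ => 1) n = Ideal.span (Set.range u) ^ n := by
  apply le_antisymm
  · -- a generator `u^α` with `Σ αᵢ ≥ n` lies in `(u)^{Σ α} ⊆ (u)ⁿ`
    unfold weightedMonomialIdeal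
    rw [Ideal.span_le]
    rintro x ⟨α, hα, rfl⟩
    simp only [one_mul] at hα
    have hmem : ∏ i, u i ^ α i ∈ Ideal.span (Set.range u) ^ (∑ i, α i) := by
      rw [← Finset.prod_pow_eq_pow_sum]
      exact Ideal.prod_mem_prod fun i _ => Ideal.pow_mem_pow (Ideal.subset_span (Set.mem_range_self i)) _
    exact Ideal.pow_le_pow_right hα hmem
  · -- `(u) ⊆ 𝒥₁` and `𝒥₁ⁿ ⊆ 𝒥ₙ`
    have h1 : Ideal.span (Set.range u) ≤ weightedMonomialIdeal u (fun _ => 1) 1 := by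
      rw [Ideal.span_le]
      rintro _ ⟨i, rfl⟩
      refine Ideal.subset_span ⟨Pi.single i 1, ?_, ?_⟩
      · rw [Finset.sum_eq_single i (fun j _ hj => by simp [hj])
          (fun hi => absurd (Finset.mem_univ i) hi)]
        simp
      · rw [Finset.prod_eq_single i (fun j _ hj => by simp [hj])
          (fun hi => absurd (Finset.mem_univ i) hi)]
        simp
    refine (Ideal.pow_right_mono h1 n).trans ?_
    induction n with
    | zero => rw [pow_zero, Ideal.one_eq_top, weightedMonomialIdeal_zero]
    | succ n ih =>
      rw [pow_succ]
      exact (Ideal.mul_mono ih le_rfl).trans (weightedMonomialIdeal_mul_le u _ n 1)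

end Algebra

/-! ## §2 Local algebra: a part of a regular system of parameters has linearly independent differentials -/

/-- **Matsumura 14.2, (1) ⇒ (2)**: if `z₁, …, z_n` is part of a regular system of parameters of the local
ring `R`, the images `dzᵢ ∈ 𝔪/𝔪²` are linearly independent over the residue field (extend to a minimal basis
of `𝔪` and use `mem_maximalIdeal_of_sum_mul_rsop_mem_sq`). [cite: Matsumura1987, Thm. 14.2] -/
theorem linearIndependent_toCotangent_of_isRsopPart {R : Type*} [CommRing R] [IsLocalRing R] {n : ℕ}
    {z : Fin n → R} (hz : IsRsopPart z) (hmem : ∀ i, z i ∈ maximalIdeal R) :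
    LinearIndependent (ResidueField R) (fun i => (maximalIdeal R).toCotangent ⟨z i, hmem i⟩) := by
  haveI := hz.isRegularLocalRing
  rw [linearIndependent_toCotangent_iff_forall_mem]
  intro c hc i
  obtain ⟨e, x, hd, hx, hxz⟩ := hz.exists_rsop
  let c' : Fin (n + e) → R := Fin.append c 0
  have hsum : ∑ k, c' k * x k = ∑ i, c i * z i := by
    rw [Fin.sum_univ_add]
    simp [c', hxz]
  have h := mem_maximalIdeal_of_sum_mul_rsop_mem_sq hd x hx c' (by rw [hsum]; exact hc)
    (Fin.castAdd e i)
  simpa [c'] using h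

/-! ## §3 Affine bookkeeping: ideals of `Γ(Y, U)` read on the stalks at the points of `U` -/

section Affine

variable {Y : Scheme.{u}}

/-- **An inclusion of ideals of `Γ(Y, U)`, `U` affine, can be checked on the stalks `𝒪_{Y,y}`, `y ∈ U`**
(they are the localisations of `Γ(Y, U)` at its primes). [folklore] -/
theorem ideal_le_of_forall_map_germ_le (U : Y.affineOpens) {I₁ I₂ : Ideal Γ(Y, U)}
    (h : ∀ (y : Y) (hy : y ∈ (U : Y.Opens)),
      I₁.map (Y.presheaf.germ U y hy).hom ≤ I₂.map (Y.presheaf.germ U y hy).hom) :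
    I₁ ≤ I₂ := by
  refine Ideal.le_of_localization_maximal fun P hP => ?_
  haveI := hP.isPrime
  let q : PrimeSpectrum Γ(Y, U) := ⟨P, hP.isPrime⟩
  have hy : U.2.fromSpec q ∈ (U : Y.Opens) := U.2.range_fromSpec.le ⟨q, rfl⟩
  letI : Algebra Γ(Y, U) (Y.presheaf.stalk (U.2.fromSpec q)) :=
    (Y.presheaf.germ U (U.2.fromSpec q) hy).hom.toAlgebra
  haveI : IsLocalization.AtPrime (Y.presheaf.stalk (U.2.fromSpec q)) P :=
    U.2.isLocalization_stalk' q hy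
  let e : Localization.AtPrime P ≃ₐ[Γ(Y, U)] Y.presheaf.stalk (U.2.fromSpec q) :=
    IsLocalization.algEquiv P.primeCompl _ _
  have key := h (U.2.fromSpec q) hy
  have key' := Ideal.map_mono (f := e.symm.toAlgHom.toRingHom) key
  rw [Ideal.map_map, Ideal.map_map] at key'
  have hcomp : e.symm.toAlgHom.toRingHom.comp (Y.presheaf.germ U (U.2.fromSpec q) hy).hom =
      algebraMap Γ(Y, U) (Localization.AtPrime P) :=
    RingHom.ext fun a => e.symm.commutes a
  rwa [hcomp] at key'

/-- Equality of ideals of `Γ(Y, U)` from equality of their images in all stalks. [folklore] -/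
theorem ideal_eq_of_forall_map_germ_eq (U : Y.affineOpens) {I₁ I₂ : Ideal Γ(Y, U)}
    (h : ∀ (y : Y) (hy : y ∈ (U : Y.Opens)),
      I₁.map (Y.presheaf.germ U y hy).hom = I₂.map (Y.presheaf.germ U y hy).hom) :
    I₁ = I₂ :=
  le_antisymm (ideal_le_of_forall_map_germ_le U fun y hy => (h y hy).le)
    (ideal_le_of_forall_map_germ_le U fun y hy => (h y hy).ge)

/-- **Off the support an ideal sheaf has unit sections**: if no point of the affine open `U` lies in
`Supp(𝒪/J)` then `J(U) = Γ(Y, U)` (a proper `J(U)` lies in a maximal ideal, whose point of `U` would be in the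
support). [folklore] -/
theorem ideal_eq_top_of_forall_not_mem_support (J : Y.IdealSheafData) (U : Y.affineOpens)
    (hU : ∀ y ∈ (U : Y.Opens), y ∉ J.support) : J.ideal U = ⊤ := by
  by_contra hne
  obtain ⟨P, hP, hle⟩ := Ideal.exists_le_maximal _ hne
  let q : PrimeSpectrum Γ(Y, U) := ⟨P, hP.isPrime⟩
  have hy : U.2.fromSpec q ∈ (U : Y.Opens) := U.2.range_fromSpec.le ⟨q, rfl⟩
  refine hU _ hy ((Scheme.IdealSheafData.mem_support_iff_of_mem hy).mpr ?_)
  have hq : q ∈ U.2.fromSpec ⁻¹' Y.zeroLocus (U := U) (J.ideal U : Set Γ(Y, U)) := by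
    rw [U.2.fromSpec_preimage_zeroLocus]; exact hle
  exact hq

end Affine

/-! ## §4 The theorem -/

/-- In a Noetherian ring: if every element of the ideal `I` is multiplied into `J` by SOME element outside the
prime `p`, then ONE `g ∉ p` does it for all of `I`. [folklore] -/
private theorem exists_not_mem_forall_mul_mem {A : Type*} [CommRing A] [IsNoetherianRing A]
    (I J p : Ideal A) [p.IsPrime] (h : ∀ x ∈ I, ∃ s ∉ p, s * x ∈ J) :
    ∃ g ∉ p, ∀ x ∈ I, g * x ∈ J := by
  classical
  obtain ⟨T, hT⟩ := (IsNoetherian.noetherian I : I.FG)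
  choose! s hs using h
  refine ⟨∏ t ∈ T, s t, ?_, ?_⟩
  · have hmem : (∏ t ∈ T, s t) ∈ p.primeCompl :=
      prod_mem fun t htT => show s t ∈ p.primeCompl from (hs t (hT ▸ Ideal.subset_span htT)).1
    exact hmem
  · intro x hx
    rw [← hT] at hx
    refine Submodule.span_induction (p := fun x _ => (∏ t ∈ T, s t) * x ∈ J) ?_ ?_ ?_ ?_ hx
    · intro t htT
      obtain ⟨w, hw⟩ : s t ∣ ∏ t' ∈ T, s t' := Finset.dvd_prod_of_mem s htT
      rw [hw, mul_comm (s t) w, mul_assoc]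
      exact Ideal.mul_mem_left _ _ (hs t (hT ▸ Ideal.subset_span htT)).2
    · simp
    · intro x y _ _ hx hy
      rw [mul_add]
      exact add_mem hx hy
    · intro a x _ hx
      rw [smul_eq_mul, mul_left_comm]
      exact Ideal.mul_mem_left _ _ hx

/-- **Powers of the ideal of a regular closed subscheme form a regular weighted centre, all weights `1`**
(Włodarczyk 2.1.10 / Lemma 4.6.1). Let `Y` be locally Noetherian with regular local rings at the points of
`V(J)`, and let the closed subscheme `V(J)` of the ideal sheaf `J` be regular. Then a Rees algebra `R` on `Y`
with pieces `Rₙ = Jⁿ` is a regular weighted centre: every point has an affine chart `(U, u₁…u_r, w ≡ 1)` with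
`Jⁿ(U) = (u^α : Σ αᵢ ≥ n)` and `u` part of a regular system of parameters of `𝒪_{Y,y'}` at every point `y'` of
`U` where all `uᵢ` vanish. Off `V(J)` the chart is the unit one; at a point of `V(J)` it is the system of
local equations of the regular centre spread to an affine neighbourhood
(`exists_affineOpen_forall_isRsopPart_germ`), shrunk to a basic open on which these equations generate `J`.
[cite: Wlodarczyk2022, 2.1.10 and Lemma 4.6.1] -/
theorem isRegularWeightedCentre_of_piece_eq_pow {Y : Scheme.{u}} [IsLocallyNoetherian Y]
    (J : Y.IdealSheafData) (hJ : Scheme.IsRegular J.subscheme)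
    (hY : ∀ y ∈ J.support, IsRegularLocalRing (Y.presheaf.stalk y))
    (R : ReesAlgebraData Y) (hR : ∀ n, R.piece n = J ^ n) :
    R.IsRegularWeightedCentre := by
  classical
  intro y
  by_cases hyC : y ∈ J.support
  swap
  · /- off the centre: the unit chart on an affine neighbourhood missing `V(J)` -/
    have hyO : y ∈ (J.support : Closeds Y).compl := hyC
    obtain ⟨U', hU', hyU, hsub⟩ := exists_isAffineOpen_mem_and_subset (X := Y) (x := y) hyO
    have htop : J.ideal ⟨U', hU'⟩ = ⊤ :=
      ideal_eq_top_of_forall_not_mem_support J ⟨U', hU'⟩ fun z hz hzC => hsub hz hzC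
    refine ⟨⟨U', hU'⟩, hyU, 1, fun _ => 1, fun _ => 1, ⟨fun _ => Nat.one_pos, fun n => ?_, ?_⟩⟩
    · rw [hR, Scheme.IdealSheafData.ideal_pow, Pi.pow_apply, htop, ReesAlgebraData.weightedMonomialIdeal_one,
        Ideal.top_pow]
    · intro y' hy' h
      have h0 := h 0
      rw [map_one] at h0
      exact absurd (Ideal.eq_top_of_isUnit_mem _ h0 isUnit_one) (maximalIdeal.isMaximal _).ne_top
  /- at a point of the centre -/
  have hJv : J = Scheme.IdealSheafData.vanishingIdeal J.support :=
    eq_vanishingIdeal_support_of_isRegular J hJ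
  have hreg : Scheme.IsRegular (Scheme.IdealSheafData.vanishingIdeal J.support).subscheme := hJv ▸ hJ
  obtain ⟨V, hyV, r, g, hg⟩ := exists_affineOpen_forall_isRsopPart_germ J.support hreg hY hyC
  simp_rw [← hJv] at hg
  haveI : IsNoetherianRing Γ(Y, V) := IsLocallyNoetherian.component_noetherian V
  -- `𝒪_{Y,y} = Γ(Y, V)_𝔭`
  let xy : (V : Y.Opens) := ⟨y, hyV⟩
  letI algy : Algebra Γ(Y, V) (Y.presheaf.stalk y) := TopCat.Presheaf.algebra_section_stalk Y.presheaf xy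
  haveI hlocy : IsLocalization.AtPrime (Y.presheaf.stalk y) (V.2.primeIdealOf xy).asIdeal :=
    V.2.isLocalization_stalk xy
  set P := (V.2.primeIdealOf xy).asIdeal with hP
  have halgy : ∀ f : Γ(Y, V), algebraMap Γ(Y, V) (Y.presheaf.stalk y) f = (Y.presheaf.germ V y hyV).hom f := fun _ => rfl
  set I : Ideal Γ(Y, V) := J.ideal V with hI
  set I' : Ideal Γ(Y, V) := Ideal.span (Set.range g) with hI'
  -- at `y` the two ideals have the same stalk
  have hIy : I.map (algebraMap Γ(Y, V) (Y.presheaf.stalk y)) = I'.map (algebraMap Γ(Y, V) (Y.presheaf.stalk y)) := by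
    have h2 := (hg y hyV hyC).2
    rw [stalkIdeal_eq_map_germ J V hyV] at h2
    rw [hI', Ideal.map_span, ← Set.range_comp]
    exact h2.symm
  -- one multiplier `s ∉ 𝔭` with `s · I ⊆ I'`
  have hmul : ∀ x ∈ I, ∃ s ∉ P, s * x ∈ I' := fun x hx => by
    have hx' : algebraMap Γ(Y, V) (Y.presheaf.stalk y) x ∈ I'.map (algebraMap Γ(Y, V) (Y.presheaf.stalk y)) :=
      hIy ▸ Ideal.mem_map_of_mem _ hx
    exact (IsLocalization.algebraMap_mem_map_algebraMap_iff P.primeCompl _ I' x).mp hx'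
  obtain ⟨s, hsP, hs⟩ := exists_not_mem_forall_mul_mem I I' P hmul
  -- the chart `U = D(s) ∋ y`
  have hys : y ∈ Y.basicOpen s := by
    rw [Scheme.mem_basicOpen _ _ _ hyV, ← halgy]
    exact (IsLocalization.AtPrime.isUnit_to_map_iff (Y.presheaf.stalk y) P s).mpr hsP
  let U : Y.affineOpens := Y.affineBasicOpen s
  have hUV : (U : Y.Opens) ≤ V := Y.basicOpen_le s
  let ρ : Γ(Y, V) →+* Γ(Y, U) := (Y.presheaf.map (homOfLE hUV).op).hom
  -- germs of restrictions
  have hgerm : ∀ (η : Y) (hη : η ∈ (U : Y.Opens)) (f : Γ(Y, V)),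
      (Y.presheaf.germ (U : Y.Opens) η hη).hom (ρ f) = (Y.presheaf.germ V η (hUV hη)).hom f :=
    fun η hη f => TopCat.Presheaf.germ_res_apply Y.presheaf (homOfLE hUV) η hη f
  -- KEY: a point of `U` where all `g_j` vanish lies on the centre
  have key : ∀ (η : Y) (hη : η ∈ (U : Y.Opens)),
      (∀ j, (Y.presheaf.germ V η (hUV hη)).hom (g j) ∈ maximalIdeal (Y.presheaf.stalk η)) → η ∈ J.support := by
    intro η hη hm
    by_contra hηC
    have htop : I.map (Y.presheaf.germ V η (hUV hη)).hom = ⊤ := by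
      rw [hI, ← stalkIdeal_eq_map_germ J V (hUV hη)]
      exact stalkIdeal_eq_top_of_not_mem_support hηC
    have hsu : IsUnit ((Y.presheaf.germ V η (hUV hη)).hom s) := (Scheme.mem_basicOpen _ _ _ (hUV hη)).mp hη
    have hle : I.map (Y.presheaf.germ V η (hUV hη)).hom ≤ I'.map (Y.presheaf.germ V η (hUV hη)).hom := by
      rw [Ideal.map_le_iff_le_comap]
      intro x hx
      obtain ⟨w, hw⟩ := hsu
      have h1 : (Y.presheaf.germ V η (hUV hη)).hom (s * x) ∈ I'.map (Y.presheaf.germ V η (hUV hη)).hom :=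
        Ideal.mem_map_of_mem _ (hs x hx)
      rw [map_mul, ← hw] at h1
      have h2 : (Y.presheaf.germ V η (hUV hη)).hom x = ↑w⁻¹ * (↑w * (Y.presheaf.germ V η (hUV hη)).hom x) := by
        rw [← mul_assoc, Units.inv_mul, one_mul]
      rw [Ideal.mem_comap, h2]
      exact Ideal.mul_mem_left _ _ h1
    have hle' : I'.map (Y.presheaf.germ V η (hUV hη)).hom ≤ maximalIdeal (Y.presheaf.stalk η) := by
      rw [hI', Ideal.map_span, Ideal.span_le]
      rintro _ ⟨_, ⟨j, rfl⟩, rfl⟩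
      exact hm j
    exact (maximalIdeal.isMaximal (Y.presheaf.stalk η)).ne_top (top_le_iff.mp (htop ▸ hle.trans hle'))
  -- the stalks of `J` on `U` are generated by the germs of `g`
  have hstalk : ∀ (η : Y) (hη : η ∈ (U : Y.Opens)),
      stalkIdeal J η = Ideal.span (Set.range fun j => (Y.presheaf.germ V η (hUV hη)).hom (g j)) := by
    intro η hη
    by_cases hηC : η ∈ J.support
    · exact ((hg η (hUV hη) hηC).2).symm
    · rw [stalkIdeal_eq_top_of_not_mem_support hηC]
      symm
      by_contra hne
      refine hηC (key η hη fun j => ?_)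
      have hj : (Y.presheaf.germ V η (hUV hη)).hom (g j) ∈
          Ideal.span (Set.range fun j => (Y.presheaf.germ V η (hUV hη)).hom (g j)) :=
        Ideal.subset_span (Set.mem_range_self j)
      exact le_maximalIdeal hne hj
  -- hence `J(U) = (g|_U)`
  have hJU : J.ideal U = Ideal.span (Set.range fun j => ρ (g j)) := by
    refine ideal_eq_of_forall_map_germ_eq U fun η hη => ?_
    have hcomp : ((Y.presheaf.germ (U : Y.Opens) η hη).hom ∘ fun j => ρ (g j)) =
        fun j => (Y.presheaf.germ V η (hUV hη)).hom (g j) :=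
      funext fun j => hgerm η hη (g j)
    rw [← stalkIdeal_eq_map_germ J U hη, hstalk η hη, Ideal.map_span, ← Set.range_comp, hcomp]
  refine ⟨U, hys, r, fun j => ρ (g j), fun _ => 1, ⟨fun _ => Nat.one_pos, fun n => ?_, ?_⟩⟩
  · -- the pieces: `Jⁿ(U) = (g)ⁿ = (g^α : Σ α ≥ n)`
    rw [hR, Scheme.IdealSheafData.ideal_pow, Pi.pow_apply, hJU, weightedMonomialIdeal_one_eq_pow]
  · -- linear independence at the points of `V(g) ∩ U ⊆ V(J)`
    intro y' hy' hm
    have hm' : ∀ j, (Y.presheaf.germ V y' (hUV hy')).hom (g j) ∈ maximalIdeal (Y.presheaf.stalk y') :=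
      fun j => hgerm y' hy' (g j) ▸ hm j
    have hy'C : y' ∈ J.support := key y' hy' hm'
    have hli := linearIndependent_toCotangent_of_isRsopPart (hg y' (hUV hy') hy'C).1 hm'
    have hfun : (fun j => (maximalIdeal (Y.presheaf.stalk y')).toCotangent ⟨_, hm j⟩) =
        fun j => (maximalIdeal (Y.presheaf.stalk y')).toCotangent ⟨_, hm' j⟩ :=
      funext fun j => congrArg _ (Subtype.ext (hgerm y' hy' (g j)))
    rw [hfun]
    exact hli

/-- The support of a Rees algebra with pieces `Jⁿ` is `V(J)`. [folklore] -/
theorem support_eq_of_piece_eq_pow {Y : Scheme.{u}} (J : Y.IdealSheafData)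
    (R : ReesAlgebraData Y) (hR : ∀ n, R.piece n = J ^ n) : R.support = (J.support : Set Y) := by
  ext y
  rw [R.mem_support_iff]
  constructor
  · intro h
    have h1 := h 1 Nat.one_pos
    rwa [hR, pow_one] at h1
  · intro hy n hn
    rwa [hR, Scheme.IdealSheafData.support_pow _ n hn.ne']

/-- **On a regular scheme the pieces `Jⁿ` of a regular centre `V(J)` form a regular weighted centre**
(the case `Scheme.IsRegular Y` of `isRegularWeightedCentre_of_piece_eq_pow`; the name is the one under which the
door's designer memo asked for this helper). [cite: Wlodarczyk2022, 2.1.10] -/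
theorem isRegularWeightedCentre_powers_of_isRegular {Y : Scheme.{u}}
    [IsLocallyNoetherian Y] (hY : Scheme.IsRegular Y) (J : Y.IdealSheafData)
    (hJ : Scheme.IsRegular J.subscheme) (R : ReesAlgebraData Y) (hR : ∀ n, R.piece n = J ^ n) :
    R.IsRegularWeightedCentre :=
  isRegularWeightedCentre_of_piece_eq_pow J hJ (fun y _ => hY y) R hR

/-- **Regular weighted centres with prescribed regular support exist**: on a regular locally Noetherian
scheme `Y`, every ideal sheaf `J` with regular closed subscheme `V(J)` is carried by a regular weighted centre
— the Rees algebra of its powers — with support `V(J)`. (Non-vacuity of the door's clause `(iii-a)` beyond the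
empty centre `isRegularWeightedCentre_unit`.) [cite: Wlodarczyk2022, 2.1.10 and Lemma 4.6.1] -/
theorem exists_isRegularWeightedCentre_support_eq {Y : Scheme.{u}} [IsLocallyNoetherian Y]
    (hY : Scheme.IsRegular Y) (J : Y.IdealSheafData) (hJ : Scheme.IsRegular J.subscheme) :
    ∃ R : ReesAlgebraData Y, R.IsRegularWeightedCentre ∧ R.support = (J.support : Set Y) ∧
      ∀ n, R.piece n = J ^ n := by
  let R : ReesAlgebraData Y :=
    { piece := fun n => J ^ n
      piece_zero := by rw [pow_zero]; rfl
      piece_mul_le := fun m n => by rw [← pow_add] }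
  exact ⟨R, isRegularWeightedCentre_powers_of_isRegular hY J hJ R (fun _ => rfl),
    support_eq_of_piece_eq_pow J R (fun _ => rfl), fun _ => rfl⟩

/-- `Spec` of a field is a regular scheme (its only local ring is the field). [folklore] -/
private theorem isRegular_Spec_field (k : Type u) [Field k] : Scheme.IsRegular (Spec (.of k)) := by
  apply Scheme.IsRegular.of_topologicalKrullDim_le_zero
  show topologicalKrullDim (PrimeSpectrum k) ≤ 0
  rw [PrimeSpectrum.topologicalKrullDim_eq_ringKrullDim, ringKrullDim_eq_zero_of_field]

/-- **The door's setting**: on a smooth scheme `f : Y → Spec k` over a field (hence regular and locally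
Noetherian), every regular closed subscheme `V(J)` is the support of a regular weighted centre with pieces
`Jⁿ` — e.g. a regular stratum of the singular locus of a hypersurface, the `(iii-a)`/`(iii-b′)`-admissible
centre of the junk-datum screen of crux `HypersurfaceCentreConstruction`. [cite: Wlodarczyk2022, 2.1.10] -/
theorem exists_isRegularWeightedCentre_support_eq_of_smooth {k : Type u} [Field k] {Y : Scheme.{u}}
    (f : Y ⟶ Spec (.of k)) [Smooth f] (J : Y.IdealSheafData) (hJ : Scheme.IsRegular J.subscheme) :
    ∃ R : ReesAlgebraData Y, R.IsRegularWeightedCentre ∧ R.support = (J.support : Set Y) ∧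
      ∀ n, R.piece n = J ^ n := by
  haveI : IsLocallyNoetherian Y := LocallyOfFiniteType.isLocallyNoetherian f
  have hY : Scheme.IsRegular Y := Scheme.IsRegular.of_smooth f (isRegular_Spec_field k)
  exact exists_isRegularWeightedCentre_support_eq hY J hJ

end Summit.ResolutionOfSingularities.ResolutionOfSingularities.Theorems

end
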